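import Summits.CriticalPhenomena.CardyFormulaZ2.Theorems.CardyIKTransportIKLinearTransportWallDominationDefs

/-!
# `CardyIKTransport.IKLinearTransport` (stmt-CriticalPhenomena-5076, line `pinned-diagram-exchange`, lead c8 wave 1) —
# WALL DOMINATION: the registered sub-goals `stub_linkConstGen` and `stub_wallMonotoneOffCol`

Support file (`--supports stmt-CriticalPhenomena-5076`), sorry-free.

* `stub_linkConstGen : LinkConstGen` — the sister line's `NecklaceConstStub.linkConst` with the arcs event replaced
  by black connectivity between two arbitrary OLD cells: if the last interior column of `y` is constant then black
  connectivity in the wider slab `(splitEquiv w L).symm (y, p)` between `castSucc`-embedded old cells does not depend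
  on the new column `p`.  Black connectivity is monochromatic reachability (`SlabDetStub.blackConn_iff`), the colour
  of an old cell is `p`-independent (`NecklaceConstStub.glue_fst_eq`), and the landed PATH TRANSFER
  `NecklaceConstStub.reach_transfer` is already stated for arbitrary endpoints off the new cell column `w + 1`.
* `stub_wallMonotoneOffCol : WallMonotoneOffCol` — a wall-monotone event is `OffColDetermined` at every interior
  cell column `i + 1`: the wall is cell column `0 ≠ i + 1`, so two configurations agreeing off the column have the
  same wall colouring, and by `SlabDetStub.blackConn_congr` the same wall profile.
-/

noncomputable section

namespace Summit.CriticalPhenomena.CardyFormulaZ2.Theorems.IKLinearTransport.PinnedDiagramExchange.WallDomination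

open scoped BigOperators Classical
open Finset
open Summit.CriticalPhenomena.CardyFormulaZ2.Cruxes.IKMixedBoxCrossing.DefectClosureExploration
open CylBunchStub (resLE resLast splitEquiv colConst)

namespace LinkConstGenStub

variable {w L : ℕ}

/-- A `castSucc`-embedded old cell lies off the new cell column `w + 1`. -/
theorem castSucc_ne (z : Fin (w + 1) × ZMod L) :
    ((z.1.castSucc, z.2) : Fin (w + 1 + 1) × ZMod L).1.val ≠ w + 1 := by
  show (z.1.castSucc : Fin (w + 1 + 1)).val ≠ w + 1
  rw [Fin.val_castSucc]
  exact ne_of_lt z.1.isLt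

/-- One direction of `LinkConstGen`: black connectivity between old cells of the gluing of `p` transfers to the
gluing of `q` when the last interior column is constant. -/
theorem blackConn_transfer [NeZero L] (y : CylCfg w L) (b : Bool) (hb : ∀ r, y.1 (Fin.last w, r) = b)
    (p q : (ZMod L → Bool) × (ZMod L → Bool)) (u v : Fin (w + 1) × ZMod L)
    (hB : BlackConn ((splitEquiv w L).symm (y, p)) (u.1.castSucc, u.2) (v.1.castSucc, v.2)) :
    BlackConn ((splitEquiv w L).symm (y, q)) (u.1.castSucc, u.2) (v.1.castSucc, v.2) := by
  have hbx : ∀ r, ((splitEquiv w L).symm (y, p)).1 ((Fin.last w).castSucc, r) = b := fun r => by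
    rw [NecklaceConstStub.glue_fst_castSucc, hb]
  rw [SlabDetStub.blackConn_iff] at hB ⊢
  obtain ⟨hbl, hreach⟩ := hB
  exact ⟨by rw [← NecklaceConstStub.glue_fst_eq y p q _ (castSucc_ne u)]; exact hbl,
    NecklaceConstStub.reach_transfer b hbx (NecklaceConstStub.glue_fst_eq y p q)
      (fun f hf _ => NecklaceConstStub.glue_snd_eq y p q f hf) (castSucc_ne u) hbl hreach (castSucc_ne v)⟩

end LinkConstGenStub

/-- **Registered sub-goal `stub_linkConstGen`** (`LinkConstGen`): if the last interior column of `y` is constant,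
black connectivity between old cells of the wider slab `(splitEquiv w L).symm (y, p)` does not depend on the new
column `p` (path transfer off the new column, detours inside the constant column when it is black). -/
theorem stub_linkConstGen : LinkConstGen :=
  fun _ _ _ y b hb p q u v =>
    ⟨LinkConstGenStub.blackConn_transfer y b hb p q u v, LinkConstGenStub.blackConn_transfer y b hb q p u v⟩

namespace WallMonotoneOffColStub

variable {w L : ℕ}

/-- A wall cell lies off every interior cell column `i + 1`. -/
theorem wall_ne (i : ℕ) (r : ZMod L) : (((0 : Fin (w + 1)), r) : Fin (w + 1) × ZMod L).1.val ≠ i + 1 := by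
  show ((0 : Fin (w + 1)) : ℕ) ≠ i + 1
  rw [Fin.val_zero]
  omega

/-- One direction of `OffColDetermined` for a wall-monotone event: membership transfers between two configurations
with the same colours off cell column `i + 1`, the same flags off face columns `i, i + 1` and the same block
diagram (same wall colouring; same wall profile by `SlabDetStub.blackConn_congr`). -/
theorem mem_transfer {E : Set (CylCfg w L)} (hE : WallMonotone E) {i : ℕ} (hi : i + 1 < w) {x y : CylCfg w L}
    (hcol : ∀ c : Fin (w + 1) × ZMod L, c.1.val ≠ i + 1 → x.1 c = y.1 c)
    (hflg : ∀ f : Fin w × ZMod L, f.1.val ≠ i → f.1.val ≠ i + 1 → x.2 f = y.2 f)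
    (hD : blockDiag L i hi x = blockDiag L i hi y) (hx : x ∈ E) : y ∈ E :=
  hE x y (funext fun r => hcol _ (wall_ne i r))
    (fun rs hrs => (SlabDetStub.blackConn_congr hi hcol hflg hD (wall_ne i rs.1) (wall_ne i rs.2)).1 hrs) hx

end WallMonotoneOffColStub

/-- **Registered sub-goal `stub_wallMonotoneOffCol`** (`WallMonotoneOffCol`): a wall-monotone event is determined
off every interior cell column given the block diagram around it (the wall is never the exchanged column). -/
theorem stub_wallMonotoneOffCol : WallMonotoneOffCol :=
  fun _ _ _ hE _ hi _ _ hcol hflg hD =>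
    ⟨WallMonotoneOffColStub.mem_transfer hE hi hcol hflg hD,
      WallMonotoneOffColStub.mem_transfer hE hi (fun c hc => (hcol c hc).symm)
        (fun f hf hf' => (hflg f hf hf').symm) hD.symm⟩

end Summit.CriticalPhenomena.CardyFormulaZ2.Theorems.IKLinearTransport.PinnedDiagramExchange.WallDomination

end
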